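import Mathlib
import HarnessLib
import Summits.Ventures.LatticeQCDFlow.Scoring.ChainEDFBandMinorised
import Summits.Ventures.LatticeQCDFlow.Scoring.MetropolisSweepBatchMeans

/-!
# A certified UNIFORM BAND for the printed distribution function of any observable along a
# METROPOLIS SWEEP on `G^ι` (compact group, kick covering), from ANY start — the explicit
# `(k+1)`-step certificate `ε = ((m/M)^n)^{|L|(k+1)} δ^{|ι|}` by the Haar product

HONEST FRAMING: exact (Metropolis-corrected) sampling algorithms for lattice gauge theory;
figures of merit are autocorrelation/cost numbers at stated couplings and volumes; no
continuum-physics claim.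

Venture `LatticeQCDFlow` (cell pub-lqcd), topic `Scoring`; FANOUT row 4 (`s0-u1-b`, rung S0-B).
Row 9 / row 30 certified the engine's Metropolis sweeps (`Exactness.metropolisSweep ν w n L`: one
pass through the sites `L` with `n` hits of a `ν`-kick Metropolis update each, target
`π = Z⁻¹ w · Haar^{⊗ι}`, `m ≤ w ≤ M`) by a Doeblin POWER minorised by the Haar PRODUCT
(`Exactness.metropolisSweep_nHit_minorised`: `(nHit S (k+1))(U, ·) ≥ ε · Haar^{⊗ι}` with
`ε = ((m/M)^n)^{|L|·(k+1)} · δ^{|ι|}` whenever the kick's `k`-step walk covers `δ · Haar`); row 8 gave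
the CLT and batch means of such runs (`Scoring/MetropolisSweepBatchMeans`).  This file applies row
4's band under the general certificate (`Scoring/ChainEDFBandMinorised`, minorising law ARBITRARY —
here the Haar product, not `π`): **`metropolisSweep_edf_band`** — for every measurable real
observable `O` on `G^ι` (plaquette, Wilson or Polyakov loop through a coordinate map), every
initial law `μ₀`, `N ≠ 0` and `η > 0` with `Nη ≥ 16(k+1)/ε`:
`P_{μ₀}(∃ t, η ≤ |F_π(t) − #{i<N : O(U_i) ≤ t}/N|)
   ≤ 4(⌈2/η⌉ + 1)·exp(−(Nη − 16(k+1)/ε)²/(128 N (k+1)²/ε²))`.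
The `U(1)` / `SU(2)` Wilson-action instances follow exactly as in
`Scoring/WilsonMetropolisSweepBatchMeans` (pinched Boltzmann weight).  NEW WORK of the cell
(composition); no definition is introduced.

## Content

* **`metropolisSweep_edf_band`**.

NOT CLAIMED: the size of `ε` for the engine's actual parameters (it is exponentially small in the
volume — an honest but weak certificate); sharper certificates; the Wilson-action specialisations
(one line each from `Exactness.wilsonBoltzmann_pinched`, not typed here).
-/

noncomputable section

namespace Summit.Ventures.LatticeQCDFlow.Scoring

open MeasureTheory ProbabilityTheory Filter Finset Preorder Literature.Probability.MarkovChains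
open Literature.MathematicalPhysics.QuantumFieldTheory (haarProbability)
open Summit.Ventures.LatticeQCDFlow.Scoring.GlivenkoCantelli
open scoped ENNReal Topology

section Sweep

variable {ι : Type*} [Fintype ι] [DecidableEq ι] {G : Type*} [TopologicalSpace G] [Group G]
  [IsTopologicalGroup G] [CompactSpace G] [MeasurableSpace G] [BorelSpace G] [SecondCountableTopology G]
  {ν : Measure G} [IsProbabilityMeasure ν] [ν.IsInvInvariant] {w : (ι → G) → ℝ} {m M : ℝ} {k : ℕ}
  {δ : ℝ≥0∞}

/-- **THE UNIFORM BAND ALONG A METROPOLIS SWEEP, FROM ANY START.**  Kick law `ν` whose `k`-step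
walk covers `δ · Haar` (`δ > 0`), weight `m ≤ w ≤ M` measurable with `0 < m`, `n ≥ 1` hits, a scan
`L` through every site; `ε = ((m/M)^n)^{|L|·(k+1)}·δ^{|ι|}` the explicit `(k+1)`-step certificate by
the Haar product; `π = Z⁻¹ w · Haar^{⊗ι}`.  For every measurable real `O`, initial law `μ₀`, `N ≠ 0`,
`η > 0` with `Nη ≥ 16(k+1)/ε`:
`P_{μ₀}(∃ t, η ≤ |F_π(t) − F̂_N(t)|) ≤ 4(⌈2/η⌉ + 1)·exp(−(Nη − 16(k+1)/ε)²/(128N(k+1)²/ε²))`. [ours] -/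
theorem metropolisSweep_edf_band
    (hcov : ∀ u : G, δ • haarProbability G ≤ Exactness.nHit (Exactness.mulWalk ν) k u) (hδ : 0 < δ)
    (hw : Measurable w) (hm : 0 < m) (hwm : ∀ U, m ≤ w U) (hwM : ∀ U, w U ≤ M) {n : ℕ} (hn : 1 ≤ n)
    {L : List ι} (hL : ∀ j, j ∈ L) {O : (ι → G) → ℝ} (hO : Measurable O)
    (μ₀ : Measure (ι → G)) [IsProbabilityMeasure μ₀] {N : ℕ} (hN : N ≠ 0) {η : ℝ} (hη : 0 < η)
    (hNη : 16 * ((k + 1 : ℕ) : ℝ)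
        / (((ENNReal.ofReal (m / M) ^ n) ^ L.length) ^ (k + 1) * δ ^ Fintype.card ι).toReal
      ≤ N * η)
    [hK : IsMarkovKernel (Exactness.metropolisSweep ν w n L)] :
    (Kernel.trajMeasure (X := fun _ : ℕ => ι → G) μ₀
        (fun t : ℕ => (Exactness.metropolisSweep ν w n L).comap
          (fun h : (i : ↥(Finset.Iic t)) → (ι → G) => h ⟨t, Finset.mem_Iic.2 le_rfl⟩)
          (measurable_pi_apply _))).real
        {x | ∃ t : ℝ, η ≤ |cdf ((Exactness.gibbsProbability
              (Measure.pi fun _ : ι => haarProbability G) w).map O) t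
            - (∑ i ∈ Finset.range N, (Set.Iic t).indicator (1 : ℝ → ℝ) (O (x i))) / N|}
      ≤ 4 * ((⌈2 / η⌉₊ : ℝ) + 1)
          * Real.exp (-(N * η - 16 * ((k + 1 : ℕ) : ℝ)
              / (((ENNReal.ofReal (m / M) ^ n) ^ L.length) ^ (k + 1) * δ ^ Fintype.card ι).toReal) ^ 2
            / (128 * N * ((k + 1 : ℕ) : ℝ) ^ 2
              / (((ENNReal.ofReal (m / M) ^ n) ^ L.length) ^ (k + 1)
                * δ ^ Fintype.card ι).toReal ^ 2)) := by
  haveI := Exactness.isProbabilityMeasure_gibbsProbability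
    (μ := Measure.pi fun _ : ι => haarProbability G) hm hwm hwM
  haveI : IsMarkovKernel (Exactness.nHit (Exactness.metropolisSweep ν w n L) (k + 1)) :=
    Exactness.isMarkovKernel_nHit _ _
  obtain ⟨hπ, -⟩ := metropolisSweep_certificate hcov hδ hw hm hwm hwM hn hL
  have hmin := Exactness.metropolisSweep_nHit_minorised hcov hw hm hwm hwM hn hL
  have hε0 := Exactness.metropolisSweep_const_pos (k := k) hδ hm hwm hwM n L
  have hε1 : ((ENNReal.ofReal (m / M) ^ n) ^ L.length) ^ (k + 1) * δ ^ Fintype.card ι ≤ 1 := by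
    have h := Measure.le_iff'.1 (hmin 1) Set.univ
    rwa [Measure.smul_apply, smul_eq_mul, measure_univ, measure_univ, mul_one] at h
  exact minorised_measureReal_exists_edf_dev_ge_le_of_pos (μ₀ := μ₀) hπ
    (fun x B hB => Exactness.GeneralNCMC.minorised_setwise hmin x hB) (Nat.succ_pos k) hε0 hε1 hO
    hN hη hNη

end Sweep

end Summit.Ventures.LatticeQCDFlow.Scoring

end
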